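import Literature.NumberTheory.GaloisRepresentations.UniformizerModulus
import Literature.NumberTheory.GaloisRepresentations.NormUniformizer
import Mathlib.RingTheory.LocalRing.ResidueField.Basic
import HarnessLib

/-!
# `[𝒪 : ϖ𝒪] = #(𝒪/𝔪)`: the index of `ϖ𝒪` in `𝒪` is the residue cardinality, for every norm uniformizer

Topic `NumberTheory/GaloisRepresentations`; namespace `Literature.NumberTheory.GaloisRepresentations.Ultrametric`
(sub-namespace `IsUniformizer` for dot notation). Setting as in `UniformizerModulus` / `NormUniformizer`:
`F` a non-trivially normed ultrametric field, locally compact where needed.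

`UniformizerModulus.resIndex ϖ := [𝒪 : ϖ𝒪 ∩ 𝒪]` is the number the kernel normalisation
`distribHaarChar F ϖ = (resIndex ϖ)⁻¹` (`distribHaarChar_uniformizer`, Weil's `mod_K(π) = q⁻¹`) produces;
the arithmetic `q` is the residue cardinality `#(𝒪/𝔪)`. For a NORM UNIFORMIZER `ϖ`
(`NormUniformizer.IsUniformizer`: `‖ϖ‖ < 1` generating the norm group) this file proves they agree:

* `unitBallEquivInteger : unitBall F ≃+ Valued.integer F` (both are `{‖x‖ ≤ 1}`; the right side is the
  valuation ring of the norm-induced valuation `NormedField.toValued`, a scoped instance);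
* `mem_maximalIdeal_iff_norm_lt_one : x ∈ 𝔪 ↔ ‖x‖ < 1`;
* `IsUniformizer.addSubgroupOf_piBall_eq_comap_maximalIdeal` : `ϖ𝒪 ∩ 𝒪 ↔ 𝔪` (`‖x‖ ≤ ‖ϖ‖ ↔ ‖x‖ < 1`);
* `IsUniformizer.resIndex_eq_card_residueField : resIndex ϖ = Nat.card (ResidueField (Valued.integer F))`,
  hence `distribHaarChar F ϖ = (#k)⁻¹` (`distribHaarChar_eq_inv_card_residueField`), `2 ≤ #k`, and the
  residue field of a locally compact non-trivially normed ultrametric field is finite (`finite_residueField`).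

Standard: A. Weil, *Basic Number Theory* (1967), Ch. I §4, Th. 6; J.-P. Serre, *Local Fields* (1979),
Ch. II §1 [folklore]. Everything is proved (Mathlib + the two imported tree files). Novelty check
(`lean search --decl`, 2026-08-18): the tree has `resIndex`, `two_le_resIndex`, `distribHaarChar_uniformizer`
(in terms of `resIndex`) and Mathlib has `Valued.integer.*`, `IsLocalRing.ResidueField`; the identification
`resIndex ϖ = #(𝒪/𝔪)` is not in the tree. Deliberately NOT here: the identification of the residue field of a
completion `K_v` with `𝒪_K/v`, and the `ℚ_p` computation `resIndex p = p`.

## Provenance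

Reproduced for the tree under the LEAN-IN-TREE rule (2026-08-18) from the pub-hodgecm cell's package file
`HodgeCM/PerL34/LocalFactors/DilationResidue.lean` (DAG-node prover #07 lineage, seat pv07 gen 2, gate run 25;
122 lines), statements and proofs verbatim except: `LocalModulus.` ↦ the tree names of `UniformizerModulus`
(same namespace), universe-polymorphic `F : Type*`, docstrings / tags added; port by seat pv07 gen 5.
-/

set_option autoImplicit false

noncomputable section

open MeasureTheory MeasureTheory.Measure Set Metric IsLocalRing
open scoped NNReal

namespace Literature.NumberTheory.GaloisRepresentations.Ultrametric

section Residue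

open scoped NormedField

variable {F : Type*} [NontriviallyNormedField F] [IsUltrametricDist F]

/-- `𝒪` as the open additive subgroup `unitBall F = {‖x‖ ≤ 1}` IS Mathlib's valuation ring `Valued.integer F`
of the norm-induced valuation. [folklore] -/
def unitBallEquivInteger : (unitBall F : OpenAddSubgroup F).toAddSubgroup ≃+ Valued.integer F where
  toFun x := ⟨x.1, Valued.integer.mem_iff.mpr ((mem_unitBall (K := F)).mp x.2)⟩
  invFun z := ⟨z.1, (mem_unitBall (K := F)).mpr (Valued.integer.mem_iff.mp z.2)⟩
  left_inv _ := rfl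
  right_inv _ := rfl
  map_add' _ _ := rfl

/-- `unitBallEquivInteger` is the identity on underlying elements. [folklore] -/
@[simp] theorem coe_unitBallEquivInteger (x : (unitBall F : OpenAddSubgroup F).toAddSubgroup) :
    ((unitBallEquivInteger x : Valued.integer F) : F) = (x : F) := rfl

/-- `x ∈ 𝔪 ↔ ‖x‖ < 1` in the valuation ring. [folklore] -/
theorem mem_maximalIdeal_iff_norm_lt_one (x : Valued.integer F) :
    x ∈ maximalIdeal (Valued.integer F) ↔ ‖x‖ < 1 := by
  rw [IsLocalRing.mem_maximalIdeal, mem_nonunits_iff, Valued.integer.isUnit_iff_norm_eq_one]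
  exact ⟨fun h => lt_of_le_of_ne (Valued.integer.norm_le_one x) h, fun h => h.ne⟩

namespace IsUniformizer

variable {ϖ : Fˣ} (hϖ : IsUniformizer ϖ)
include hϖ

omit [IsUltrametricDist F] in
/-- For a norm uniformizer, `‖x‖ ≤ ‖ϖ‖ ↔ ‖x‖ < 1`. [folklore] -/
theorem norm_le_iff_norm_lt_one (x : F) : ‖x‖ ≤ ‖(ϖ : F)‖ ↔ ‖x‖ < 1 :=
  ⟨fun h => h.trans_lt hϖ.1, hϖ.norm_le_of_norm_lt_one x⟩

/-- Under `𝒪 ≃+ Valued.integer F`, the subgroup `ϖ𝒪 ∩ 𝒪 = {‖x‖ ≤ ‖ϖ‖}` of `𝒪` is the maximal ideal `𝔪`.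
[folklore] -/
theorem addSubgroupOf_piBall_eq_comap_maximalIdeal :
    ((piBall ϖ : OpenAddSubgroup F).toAddSubgroup).addSubgroupOf
        (unitBall F : OpenAddSubgroup F).toAddSubgroup
      = ((maximalIdeal (Valued.integer F)).toAddSubgroup).comap
          (unitBallEquivInteger (F := F)).toAddMonoidHom := by
  ext x
  rw [AddSubgroup.mem_addSubgroupOf, AddSubgroup.mem_comap]
  change (x : F) ∈ piBall ϖ ↔ unitBallEquivInteger x ∈ maximalIdeal (Valued.integer F)
  rw [mem_piBall, mem_maximalIdeal_iff_norm_lt_one, hϖ.norm_le_iff_norm_lt_one]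
  rfl

/-- **`[𝒪 : ϖ𝒪] = #(𝒪/𝔪)`**: the index `resIndex ϖ` of a norm uniformizer is the residue cardinality.
[folklore] -/
theorem resIndex_eq_card_residueField :
    resIndex ϖ = Nat.card (ResidueField (Valued.integer F)) := by
  change (((piBall ϖ : OpenAddSubgroup F).toAddSubgroup).addSubgroupOf
    (unitBall F : OpenAddSubgroup F).toAddSubgroup).index = _
  rw [hϖ.addSubgroupOf_piBall_eq_comap_maximalIdeal,
    AddSubgroup.index_comap_of_surjective (f := (unitBallEquivInteger (F := F)).toAddMonoidHom) _
      (unitBallEquivInteger (F := F)).surjective,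
    AddSubgroup.index_eq_card]
  rfl

/-- `distribHaarChar F ϖ = (#k)⁻¹` for a norm uniformizer `ϖ` of a locally compact field, `k = 𝒪/𝔪`
(Weil's `mod_K(π) = q⁻¹` with `q` the residue cardinality). [cite: WeilBNT1967, Ch. I §4, Th. 6] -/
theorem distribHaarChar_eq_inv_card_residueField [ProperSpace F] :
    distribHaarChar F ϖ = ((Nat.card (ResidueField (Valued.integer F)) : ℝ≥0))⁻¹ := by
  rw [← hϖ.resIndex_eq_card_residueField]
  exact distribHaarChar_uniformizer hϖ.1.le

/-- The residue field of a locally compact non-trivially normed ultrametric field has at least two elements.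
[folklore] -/
theorem two_le_card_residueField [ProperSpace F] : 2 ≤ Nat.card (ResidueField (Valued.integer F)) := by
  rw [← hϖ.resIndex_eq_card_residueField]
  exact two_le_resIndex hϖ.1

end IsUniformizer

/-- The residue field of a locally compact non-trivially normed ultrametric field is finite (a norm
uniformizer exists). [folklore] -/
theorem finite_residueField [ProperSpace F] : Finite (ResidueField (Valued.integer F)) := by
  obtain ⟨ϖ, hϖ⟩ := exists_isUniformizer (F := F)
  exact Nat.finite_of_card_ne_zero
    (by rw [← hϖ.resIndex_eq_card_residueField]; exact (resIndex_pos ϖ).ne')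

end Residue

end Literature.NumberTheory.GaloisRepresentations.Ultrametric

end
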